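import Summits.AtomisticToContinuum.HydrodynamicLimit.Theorems.JaynesSqueezeLocalGibbsConcentrationDiluteRatioUniform

/-!
# Uniform convergence of the insertion ratios: the coefficients and the contraction

Helper file for item `LocalGibbsConcentrationDilute` (stmt-AtomisticToContinuum-13460) of route
`JaynesSqueeze`; second part of `JaynesSqueezeLocalGibbsConcentrationDiluteRatioUniform`.

* `abs_choose_div_choose_sub_pow_le`: `|C(m,j)/C(N,j) - ((m+1)/(N+1))ʲ| ≤ j(j+1)/(N+1-j)`;
* `coefN_uniform`: the coefficients `C(m, j) W_N(j+1)` of the ratio identity converge to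
  `((m+1)/(N+1))ʲ γ_j(σ)` uniformly in `m ≤ N`;
* `qN_uniform` (**uniform convergence of the insertion ratios**): for the uniform profile at
  small reduced density `σ`, for every `ε > 0`, eventually in `N`, for all `m ≤ N`,
  `|q_N(m) - R(σ ((m+1)/(N+1))^{1/3})| ≤ ε` (strong induction on `m` at fixed `N`: small `m` are
  handled by `|q_N(m) - 1|, |R - 1| ≤ (m+1)/(N+1)`, large `m` by the tree's deterministic estimate
  at the sub-density `σ'` and the Lipschitz continuity of `R` in `σ'³`).

No definitions (pure-proof helper file). prover-pitem-stmt-AtomisticToContinuum-13460-0.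
-/

noncomputable section

namespace Summit.AtomisticToContinuum.HydrodynamicLimit.Theorems

open MeasureTheory Filter Topology Set Finset
open Literature.Analysis.FluidPDE Literature.MathematicalPhysics.KineticTheory
open Literature.MathematicalPhysics.StatisticalMechanics Literature.Probability.LatticeModels
open scoped ENNReal

namespace LocalGibbsConcentration

section UniformCoef

/-- **Ratios of binomial coefficients**: for `j ≤ m ≤ N`,
`|C(m,j)/C(N,j) - ((m+1)/(N+1))ʲ| ≤ j² / (N - j)` … precisely `≤ j (j+1)/(N + 1 - j)`.
[folklore] -/
theorem abs_choose_div_choose_sub_pow_le :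
    ∀ (j : ℕ) {m N : ℕ}, j ≤ m → m ≤ N →
      |(m.choose j : ℝ) / (N.choose j : ℝ) - (((m + 1 : ℕ) : ℝ) / ((N + 1 : ℕ) : ℝ)) ^ j| ≤
        (j : ℝ) * ((j + 1 : ℝ) / ((N : ℝ) + 1 - j))
  | 0, m, N, _, _ => by simp
  | j + 1, m, N, hjm, hmN => by
    have ih := abs_choose_div_choose_sub_pow_le j (m := m) (N := N) (by omega) hmN
    set t : ℝ := ((m + 1 : ℕ) : ℝ) / ((N + 1 : ℕ) : ℝ) with ht
    have ht0 : 0 ≤ t := by positivity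
    have ht1 : t ≤ 1 := by
      rw [ht, div_le_one (by positivity)]; exact_mod_cast Nat.succ_le_succ hmN
    -- the recursions `C(n, j+1) (j+1) = C(n, j) (n - j)`
    have hrec : ∀ {n : ℕ}, j + 1 ≤ n →
        (n.choose (j + 1) : ℝ) = (n.choose j : ℝ) * ((n : ℝ) - j) / (j + 1) := by
      intro n hn
      have h := Nat.choose_succ_right_eq n j
      have hcast : ((n.choose (j + 1) * (j + 1) : ℕ) : ℝ) = ((n.choose j * (n - j) : ℕ) : ℝ) := by
        rw [h]
      push_cast [Nat.cast_sub (show j ≤ n by omega)] at hcast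
      field_simp
      linarith
    have hNj : (0 : ℝ) < (N : ℝ) - j := by
      have : (j : ℝ) + 1 ≤ N := by exact_mod_cast (hjm.trans hmN)
      linarith
    have hCN : (0 : ℝ) < (N.choose j : ℝ) := by exact_mod_cast Nat.choose_pos (by omega)
    have hCN' : (0 : ℝ) < (N.choose (j + 1) : ℝ) := by exact_mod_cast Nat.choose_pos (by omega)
    -- the ratio recursion
    set a : ℝ := ((m : ℝ) - j) / ((N : ℝ) - j) with ha
    have hratio : (m.choose (j + 1) : ℝ) / (N.choose (j + 1) : ℝ) =
        (m.choose j : ℝ) / (N.choose j : ℝ) * a := by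
      rw [hrec hjm, hrec (hjm.trans hmN), ha]
      field_simp
    have ha0 : 0 ≤ a := div_nonneg (by
      have : (j : ℝ) + 1 ≤ m := by exact_mod_cast hjm
      linarith) hNj.le
    have ha1 : a ≤ 1 := by
      rw [ha, div_le_one hNj]; gcongr
    -- `|a - t| ≤ (j+1)/(N-j)`
    have hat : |a - t| ≤ ((j : ℝ) + 1) / ((N : ℝ) - j) := by
      have hN1 : (0 : ℝ) < (N : ℝ) + 1 := by positivity
      have heq : t - a = (((N : ℝ) - m) * (j + 1)) / (((N : ℝ) - j) * ((N : ℝ) + 1)) := by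
        rw [ha, ht]; push_cast; field_simp; ring
      rw [abs_sub_comm, heq, abs_of_nonneg (div_nonneg (mul_nonneg (by
        have : (m : ℝ) ≤ N := by exact_mod_cast hmN
        linarith) (by positivity)) (by positivity)),
        div_le_div_iff₀ (by positivity) hNj]
      have hNm : (N : ℝ) - m ≤ (N : ℝ) + 1 := by
        have : (0 : ℝ) ≤ m := Nat.cast_nonneg m
        linarith
      calc ((N : ℝ) - m) * (j + 1) * ((N : ℝ) - j) = (((N : ℝ) - m) * ((N : ℝ) - j)) * (j + 1) := by ring
        _ ≤ (((N : ℝ) + 1) * ((N : ℝ) - j)) * (j + 1) := by gcongr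
        _ = (j + 1) * (((N : ℝ) - j) * ((N : ℝ) + 1)) := by ring
    -- combine
    have hprev0 : 0 ≤ (m.choose j : ℝ) / (N.choose j : ℝ) := by positivity
    rw [hratio, pow_succ]
    have hsplit : (m.choose j : ℝ) / (N.choose j : ℝ) * a - t ^ j * t =
        ((m.choose j : ℝ) / (N.choose j : ℝ) - t ^ j) * a + t ^ j * (a - t) := by ring
    rw [hsplit]
    have htj : t ^ j ≤ 1 := pow_le_one₀ ht0 ht1
    calc |((m.choose j : ℝ) / (N.choose j : ℝ) - t ^ j) * a + t ^ j * (a - t)|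
        ≤ |(m.choose j : ℝ) / (N.choose j : ℝ) - t ^ j| * a + t ^ j * |a - t| := by
          refine (abs_add_le _ _).trans (le_of_eq ?_)
          rw [abs_mul, abs_mul, abs_of_nonneg ha0, abs_of_nonneg (pow_nonneg ht0 j)]
      _ ≤ (j : ℝ) * ((j + 1 : ℝ) / ((N : ℝ) + 1 - j)) * 1 + 1 * (((j : ℝ) + 1) / ((N : ℝ) - j)) := by
          gcongr
          · exact mul_nonneg (Nat.cast_nonneg j) (div_nonneg (by positivity) (by linarith))
      _ ≤ ((j + 1 : ℕ) : ℝ) * ((((j + 1 : ℕ) : ℝ) + 1) / ((N : ℝ) + 1 - ((j + 1 : ℕ) : ℝ))) := by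
          push_cast
          have hd : (N : ℝ) + 1 - (j + 1) = (N : ℝ) - j := by ring
          rw [hd, mul_one, one_mul]
          have h1 : (j : ℝ) * ((j + 1) / ((N : ℝ) + 1 - j)) ≤ (j : ℝ) * ((j + 1) / ((N : ℝ) - j)) := by
            refine mul_le_mul_of_nonneg_left ?_ (Nat.cast_nonneg j)
            exact div_le_div_of_nonneg_left (by positivity) hNj (by linarith)
          calc (j : ℝ) * ((j + 1) / ((N : ℝ) + 1 - j)) + (j + 1) / ((N : ℝ) - j)
              ≤ (j : ℝ) * ((j + 1) / ((N : ℝ) - j)) + (j + 1) / ((N : ℝ) - j) := by linarith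
            _ = ((j : ℝ) * (j + 1) + (j + 1)) / ((N : ℝ) - j) := by ring
            _ ≤ (j + 1) * (j + 1 + 1) / ((N : ℝ) - j) := by
                refine div_le_div_of_nonneg_right ?_ hNj.le
                nlinarith [Nat.cast_nonneg (α := ℝ) j]
            _ = (j + 1) * ((j + 1 + 1) / ((N : ℝ) - j)) := mul_div_assoc _ _ _


/-- **Uniform convergence of the coefficients.** For the uniform profile at `0 < σ < 1/2`, every
`j` and `τ > 0`: eventually in `N`, for all `m ≤ N`,
`|C(m, j) W_N(j+1) - ((m+1)/(N+1))ʲ γ_j(σ)| ≤ τ` (the cluster limit `C(N, j) W_N(j+1) → γ_j` of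
the tree and the binomial ratios). [folklore] -/
theorem coefN_uniform {σ : ℝ} (hσ : 0 < σ) (j : ℕ) {τ : ℝ} (hτ : 0 < τ) :
    ∀ᶠ N : ℕ in atTop, ∀ m : ℕ, m ≤ N →
      |coefN uniformProfile σ N (fun _ => 1) m j -
        (((m + 1 : ℕ) : ℝ) / ((N + 1 : ℕ) : ℝ)) ^ j * clusterCoeff σ j| ≤ τ := by
  set γ : ℝ := clusterCoeff σ j with hγ
  have hlim : Tendsto (fun N : ℕ => coefN uniformProfile σ N (fun _ => 1) N j) atTop (𝓝 γ) := by
    have h := tendsto_coefN (P := uniformProfile) hσ 0 j (g := fun _ => (1 : ℝ)) measurable_const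
      (C := 1) (fun _ => by simp)
    rw [coefLim_uniform] at h
    simpa only [Nat.sub_zero] using h
  have h1 : ∀ᶠ N : ℕ in atTop, |coefN uniformProfile σ N (fun _ => 1) N j - γ| ≤ min (τ / 2) 1 := by
    have := (Metric.tendsto_nhds.1 hlim) (min (τ / 2) 1) (lt_min (by positivity) one_pos)
    refine this.mono fun N hN => ?_
    rw [Real.dist_eq] at hN
    exact hN.le
  -- the vanishing rates
  have h2 : ∀ᶠ N : ℕ in atTop, ((j : ℝ) + 1) ^ 2 * (|γ| + 1) * (2 / ((N : ℝ) + 1)) ≤ τ / 2 ∧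
      (j : ℝ) * |γ| * (1 / ((N : ℝ) + 1)) ≤ τ := by
    have h0 := tendsto_one_div_add_atTop_nhds_zero_nat (𝕜 := ℝ)
    have ha := h0.const_mul (((j : ℝ) + 1) ^ 2 * (|γ| + 1) * 2)
    have hb := h0.const_mul ((j : ℝ) * |γ|)
    rw [mul_zero] at ha hb
    have ha' := (Metric.tendsto_nhds.1 ha) (τ / 2) (by positivity)
    have hb' := (Metric.tendsto_nhds.1 hb) τ hτ
    filter_upwards [ha', hb'] with N hNa hNb
    rw [Real.dist_eq, sub_zero] at hNa hNb
    refine ⟨?_, (le_abs_self _).trans hNb.le⟩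
    have := (le_abs_self _).trans hNa.le
    calc ((j : ℝ) + 1) ^ 2 * (|γ| + 1) * (2 / ((N : ℝ) + 1))
        = ((j : ℝ) + 1) ^ 2 * (|γ| + 1) * 2 * (1 / ((N : ℝ) + 1)) := by ring
      _ ≤ τ / 2 := this
  filter_upwards [h1, h2, eventually_ge_atTop (2 * j + 1)] with N hc hsmall hN m hmN
  set t : ℝ := ((m + 1 : ℕ) : ℝ) / ((N + 1 : ℕ) : ℝ) with ht
  have ht0 : 0 ≤ t := by positivity
  have ht1 : t ≤ 1 := by
    rw [ht, div_le_one (by positivity)]; exact_mod_cast Nat.succ_le_succ hmN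
  have hcτ : |coefN uniformProfile σ N (fun _ => 1) N j - γ| ≤ τ / 2 := hc.trans (min_le_left _ _)
  have hcb : |coefN uniformProfile σ N (fun _ => 1) N j| ≤ |γ| + 1 := by
    have := hc.trans (min_le_right _ _)
    have := abs_sub_abs_le_abs_sub (coefN uniformProfile σ N (fun _ => 1) N j) γ
    linarith
  by_cases hjm : j ≤ m
  · -- `C(m, j) W = (C(m,j)/C(N,j)) · C(N, j) W`
    have hCN : (N.choose j : ℝ) ≠ 0 := by
      have : 0 < N.choose j := Nat.choose_pos (by omega)
      exact_mod_cast this.ne'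
    have hfac : coefN uniformProfile σ N (fun _ => 1) m j =
        (m.choose j : ℝ) / (N.choose j : ℝ) * coefN uniformProfile σ N (fun _ => 1) N j := by
      rw [coefN, coefN]; field_simp
    have hρ := abs_choose_div_choose_sub_pow_le j hjm hmN
    rw [← ht] at hρ
    have hsplit : coefN uniformProfile σ N (fun _ => 1) m j - t ^ j * γ =
        ((m.choose j : ℝ) / (N.choose j : ℝ) - t ^ j) * coefN uniformProfile σ N (fun _ => 1) N j +
          t ^ j * (coefN uniformProfile σ N (fun _ => 1) N j - γ) := by
      rw [hfac]; ring
    rw [hsplit]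
    have htj : t ^ j ≤ 1 := pow_le_one₀ ht0 ht1
    have hNj : (0 : ℝ) < (N : ℝ) + 1 - j := by
      have : (2 * j + 1 : ℝ) ≤ N := by exact_mod_cast hN
      linarith
    have hρ0 : 0 ≤ (j : ℝ) * (((j : ℝ) + 1) / ((N : ℝ) + 1 - j)) :=
      mul_nonneg (Nat.cast_nonneg j) (div_nonneg (by positivity) hNj.le)
    have hrate : (j : ℝ) * (((j : ℝ) + 1) / ((N : ℝ) + 1 - j)) ≤ ((j : ℝ) + 1) ^ 2 * (2 / ((N : ℝ) + 1)) := by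
      have hN2 : (N : ℝ) + 1 ≤ 2 * ((N : ℝ) + 1 - j) := by
        have : (2 * j + 1 : ℝ) ≤ N := by exact_mod_cast hN
        linarith
      calc (j : ℝ) * (((j : ℝ) + 1) / ((N : ℝ) + 1 - j)) ≤ ((j : ℝ) + 1) * (((j : ℝ) + 1) / ((N : ℝ) + 1 - j)) := by
            refine mul_le_mul_of_nonneg_right (by linarith) (div_nonneg (by positivity) hNj.le)
        _ = ((j : ℝ) + 1) ^ 2 * (1 / ((N : ℝ) + 1 - j)) := by ring
        _ ≤ ((j : ℝ) + 1) ^ 2 * (2 / ((N : ℝ) + 1)) := by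
            refine mul_le_mul_of_nonneg_left ?_ (by positivity)
            rw [div_le_div_iff₀ hNj (by positivity)]
            linarith
    calc |((m.choose j : ℝ) / (N.choose j : ℝ) - t ^ j) * coefN uniformProfile σ N (fun _ => 1) N j +
          t ^ j * (coefN uniformProfile σ N (fun _ => 1) N j - γ)|
        ≤ |(m.choose j : ℝ) / (N.choose j : ℝ) - t ^ j| * |coefN uniformProfile σ N (fun _ => 1) N j| +
          t ^ j * |coefN uniformProfile σ N (fun _ => 1) N j - γ| := by
          refine (abs_add_le _ _).trans (le_of_eq ?_)
          rw [abs_mul, abs_mul, abs_of_nonneg (pow_nonneg ht0 j)]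
      _ ≤ ((j : ℝ) * (((j : ℝ) + 1) / ((N : ℝ) + 1 - j))) * (|γ| + 1) + 1 * (τ / 2) :=
          add_le_add (mul_le_mul hρ hcb (abs_nonneg _) hρ0) (mul_le_mul htj hcτ (abs_nonneg _) zero_le_one)
      _ ≤ ((j : ℝ) + 1) ^ 2 * (|γ| + 1) * (2 / ((N : ℝ) + 1)) + τ / 2 := by
          have := mul_le_mul_of_nonneg_right hrate (by positivity : (0 : ℝ) ≤ |γ| + 1)
          nlinarith
      _ ≤ τ / 2 + τ / 2 := by linarith [hsmall.1]
      _ = τ := by ring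
  · -- `m < j`: the coefficient vanishes and `tʲ γ` is small
    push Not at hjm
    have hzero : coefN uniformProfile σ N (fun _ => 1) m j = 0 := by
      rw [coefN, Nat.choose_eq_zero_of_lt hjm]; simp
    rw [hzero, zero_sub, abs_neg, abs_mul, abs_of_nonneg (pow_nonneg ht0 j)]
    have hj1 : 1 ≤ j := by omega
    have htj : t ^ j ≤ t := by
      calc t ^ j ≤ t ^ 1 := pow_le_pow_of_le_one ht0 ht1 hj1
        _ = t := pow_one t
    have htle : t ≤ (j : ℝ) * (1 / ((N : ℝ) + 1)) := by
      rw [ht]; push_cast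
      rw [mul_one_div, div_le_div_iff₀ (by positivity) (by positivity)]
      have : (m : ℝ) + 1 ≤ j := by exact_mod_cast hjm
      nlinarith
    calc t ^ j * |γ| ≤ ((j : ℝ) * (1 / ((N : ℝ) + 1))) * |γ| :=
          mul_le_mul_of_nonneg_right (htj.trans htle) (abs_nonneg _)
      _ = (j : ℝ) * |γ| * (1 / ((N : ℝ) + 1)) := by ring
      _ ≤ τ := hsmall.2

end UniformCoef

section Contraction

/-- **Uniform convergence of the insertion ratios at all sub-densities.** For the uniform profile
at small reduced density `σ` and every `ε > 0`: eventually in `N`, for all `m ≤ N`,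
`|q_N(m) - R(σ ((m+1)/(N+1))^{1/3})| ≤ ε`. [folklore] -/
theorem qN_uniform {σ : ℝ} (h : SmallDensity uniformProfile σ) {ε : ℝ} (hε : 0 < ε) :
    ∀ᶠ N : ℕ in atTop, ∀ m : ℕ, m ≤ N →
      |qN uniformProfile σ N m -
        ratioLimit uniformProfile (σ * (((m + 1 : ℕ) : ℝ) / ((N + 1 : ℕ) : ℝ)) ^ (1 / 3 : ℝ))| ≤ ε := by
  have hσ := h.σ_pos
  have hθ0 : 0 ≤ geomRatio uniformProfile σ := geomRatio_nonneg hσ.le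
  have hθ1 := h.geomRatio_lt_one
  set κ : ℝ := contractionC uniformProfile σ with hκ
  have hκ0 : 0 ≤ κ := h.contractionC_nonneg
  have hκ1 : 4 * κ < 1 := h.four_contractionC_lt_one
  set L : ℝ := 8 * (2 * Real.exp 1 ^ 2 * v₁ / (1 - geomRatio uniformProfile σ) ^ 2) with hL
  have hL0 : 0 ≤ L := by have := v₁_pos; positivity
  -- the budget
  set b : ℝ := ε * (1 - 4 * κ) / 4 with hb
  have hb0 : 0 < b := by rw [hb]; exact div_pos (mul_pos hε (by linarith)) (by norm_num)
  -- choose `J` with a small geometric tail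
  have htail : Tendsto (fun J => geomTail uniformProfile σ J) atTop (𝓝 0) := by
    have h1 := (tendsto_pow_atTop_nhds_zero_of_lt_one hθ0 hθ1).comp (tendsto_add_atTop_nat 1)
    have h2 := h1.mul_const (Real.exp 1 / (1 - geomRatio uniformProfile σ))
    rw [zero_mul] at h2
    refine h2.congr fun J => ?_
    simp only [Function.comp_apply, geomTail]; ring
  obtain ⟨J, hJ⟩ := ((Metric.tendsto_nhds.1 htail) (b / 8) (by positivity)).exists
  rw [Real.dist_eq, sub_zero, abs_of_nonneg (h.geomTail_nonneg J)] at hJ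
  -- the coefficient tolerance
  set τ : ℝ := b / (4 * ((J : ℝ) + 1) * 2 ^ J) with hτ
  have hτ0 : 0 < τ := by positivity
  have hcoef : ∀ᶠ N : ℕ in atTop, ∀ j ∈ Finset.range (J + 1), ∀ m : ℕ, m ≤ N →
      |coefN uniformProfile σ N (fun _ => 1) m j -
        (((m + 1 : ℕ) : ℝ) / ((N + 1 : ℕ) : ℝ)) ^ j * clusterCoeff σ j| ≤ τ := by
    rw [eventually_all_finset]
    intro j _
    exact coefN_uniform hσ j hτ0
  -- the `1/(N+1)` terms
  have hsmallN : ∀ᶠ N : ℕ in atTop, 4 * κ * L * σ ^ 3 * (J : ℝ) * (1 / ((N : ℝ) + 1)) ≤ b ∧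
      2 * ((J : ℝ) + 1) * (1 / ((N : ℝ) + 1)) ≤ ε := by
    have h0 := tendsto_one_div_add_atTop_nhds_zero_nat (𝕜 := ℝ)
    have ha := h0.const_mul (4 * κ * L * σ ^ 3 * (J : ℝ))
    have hb' := h0.const_mul (2 * ((J : ℝ) + 1))
    rw [mul_zero] at ha hb'
    filter_upwards [(Metric.tendsto_nhds.1 ha) b hb0, (Metric.tendsto_nhds.1 hb') ε hε] with N h1 h2
    rw [Real.dist_eq, sub_zero] at h1 h2
    exact ⟨(le_abs_self _).trans h1.le, (le_abs_self _).trans h2.le⟩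
  filter_upwards [hcoef, hsmallN] with N hcN hsN
  -- strong induction on `m`
  intro m
  induction m using Nat.strong_induction_on with
  | _ m IH =>
    intro hmN
    set t : ℕ → ℝ := fun k => ((k + 1 : ℕ) : ℝ) / ((N + 1 : ℕ) : ℝ) with ht
    set σ' : ℕ → ℝ := fun k => σ * (t k) ^ (1 / 3 : ℝ) with hσ'
    have hσ'small : ∀ k ≤ N, SmallDensity uniformProfile (σ' k) := fun k hk =>
      smallDensity_uniform_mono h (subSigma_pos hσ N k) (subSigma_le hσ.le hk)
    have htm_pos : 0 < t m := by rw [ht]; positivity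
    by_cases hsmall : 2 * t m ≤ ε
    · -- small `m`: both `q` and `R` are within `t` of `1`
      have hq := abs_qN_sub_one_le h hmN
      have hR := abs_ratioLimit_subSigma_sub_one_le h hmN
      calc |qN uniformProfile σ N m - ratioLimit uniformProfile (σ' m)|
          ≤ |qN uniformProfile σ N m - 1| + |1 - ratioLimit uniformProfile (σ' m)| := abs_sub_le _ _ _
        _ ≤ t m + t m := add_le_add hq (by rw [abs_sub_comm]; exact hR)
        _ ≤ ε := by linarith
    · -- large `m`: the deterministic estimate at `(σ' m, m)`
      push Not at hsmall
      -- `J ≤ m`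
      have hJm : J ≤ m := by
        by_contra hlt
        push Not at hlt
        have : 2 * t m ≤ ε := by
          calc 2 * t m = 2 * (((m + 1 : ℕ) : ℝ) * (1 / ((N : ℝ) + 1))) := by
                rw [ht]; push_cast; ring
            _ ≤ 2 * (((J : ℝ) + 1) * (1 / ((N : ℝ) + 1))) := by
                gcongr; exact_mod_cast (show m + 1 ≤ J + 1 by omega)
            _ = 2 * ((J : ℝ) + 1) * (1 / ((N : ℝ) + 1)) := by ring
            _ ≤ ε := hsN.2
        linarith
      have h' := hσ'small m hmN
      have hdiam : hsDiameter (σ' m) m = hsDiameter σ N := hsDiameter_subSigma hσ.le N m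
      set R : ℕ → ℝ := fun k => ratioLimit uniformProfile (σ' k) with hR
      -- the shifted ratios, within `η` of `R m`
      set η : ℝ := ε + L * σ ^ 3 * (J : ℝ) * (1 / ((N : ℝ) + 1)) with hη
      have hη0 : 0 ≤ η := by positivity
      have hq : ∀ i < J, |qN uniformProfile (σ' m) m (m - 0 - 1 - i) - R m| ≤ η := by
        intro i hi
        have hk : m - 0 - 1 - i ≤ m := by omega
        have hklt : m - 0 - 1 - i < m := by omega
        rw [qN_eq_of_hsDiameter_eq hmN hdiam hk]
        have h1 := IH (m - 0 - 1 - i) hklt (by omega)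
        have h2 : |R (m - 0 - 1 - i) - R m| ≤ L * σ ^ 3 * (J : ℝ) * (1 / ((N : ℝ) + 1)) := by
          have hlip := abs_ratioLimit_sub_le h (hσ'small (m - 0 - 1 - i) (by omega)) h'
            (subSigma_le hσ.le (show m - 0 - 1 - i ≤ N by omega)) (subSigma_le hσ.le hmN)
          refine hlip.trans ?_
          rw [← hL]
          have hcube : |σ' (m - 0 - 1 - i) ^ 3 - σ' m ^ 3| = σ ^ 3 * (((i + 1 : ℕ) : ℝ) / ((N + 1 : ℕ) : ℝ)) := by
            simp only [hσ', ht]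
            rw [subSigma_pow_three, subSigma_pow_three, ← mul_sub, abs_mul, abs_of_pos (pow_pos hσ 3),
              div_sub_div_same, abs_div, abs_of_pos (by positivity : (0 : ℝ) < ((N + 1 : ℕ) : ℝ))]
            congr 2
            rw [abs_of_nonpos (by
              have : ((m - 0 - 1 - i + 1 : ℕ) : ℝ) ≤ ((m + 1 : ℕ) : ℝ) := by exact_mod_cast (by omega)
              linarith)]
            have : ((m + 1 : ℕ) : ℝ) - ((m - 0 - 1 - i + 1 : ℕ) : ℝ) = ((i + 1 : ℕ) : ℝ) := by
              have h3 : m - 0 - 1 - i + 1 + (i + 1) = m + 1 := by omega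
              have h4 : ((m - 0 - 1 - i + 1 : ℕ) : ℝ) + ((i + 1 : ℕ) : ℝ) = ((m + 1 : ℕ) : ℝ) := by
                exact_mod_cast h3
              linarith
            linarith
          rw [hcube]
          have hiJ : (((i + 1 : ℕ) : ℝ) / ((N + 1 : ℕ) : ℝ)) ≤ (J : ℝ) * (1 / ((N : ℝ) + 1)) := by
            push_cast
            rw [mul_one_div, div_le_div_iff₀ (by positivity) (by positivity)]
            have : (i : ℝ) + 1 ≤ J := by exact_mod_cast hi
            nlinarith
          calc L * (σ ^ 3 * (((i + 1 : ℕ) : ℝ) / ((N + 1 : ℕ) : ℝ))) ≤ L * (σ ^ 3 * ((J : ℝ) * (1 / ((N : ℝ) + 1)))) := by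
                gcongr
            _ = L * σ ^ 3 * (J : ℝ) * (1 / ((N : ℝ) + 1)) := by ring
        calc |qN uniformProfile σ N (m - 0 - 1 - i) - R m|
            ≤ |qN uniformProfile σ N (m - 0 - 1 - i) - R (m - 0 - 1 - i)| + |R (m - 0 - 1 - i) - R m| :=
              abs_sub_le _ _ _
          _ ≤ ε + L * σ ^ 3 * (J : ℝ) * (1 / ((N : ℝ) + 1)) := add_le_add h1 h2
      -- the coefficients, within `τ`
      have hc : ∀ j ≤ J, |coefN uniformProfile (σ' m) m (fun _ => 1) (m - 0) j -
          coefLim uniformProfile (σ' m) (fun _ => 1) j| ≤ τ := by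
        intro j hj
        rw [Nat.sub_zero, coefN_eq_of_hsDiameter_eq hmN hdiam measurable_const (hj.trans hJm)]
        simp only [hσ', ht]
        rw [coefLim_uniform_subSigma]
        exact hcN j (Finset.mem_range.2 (Nat.lt_succ_of_le hj)) m hmN
      -- the deterministic estimate of the tree, at `(σ' m, m, l = 0)`
      have hdet := h'.abs_inv_qN_sub_inv_le (N := m) (l := 0) (J := J) (by omega) hη0 hτ0.le hq hc
      have hinv := h'.abs_qN_sub_le_of_inv (N := m) (m := m) le_rfl
      rw [Nat.sub_zero] at hdet
      rw [qN_eq_of_hsDiameter_eq hmN hdiam le_rfl] at hinv hdet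
      -- monotone constants
      have hκ' : contractionC uniformProfile (σ' m) ≤ κ :=
        contractionC_uniform_mono h (subSigma_pos hσ N m) (subSigma_le hσ.le hmN)
      have hgt' : geomTail uniformProfile (σ' m) J ≤ geomTail uniformProfile σ J :=
        geomTail_uniform_mono h (subSigma_pos hσ N m) (subSigma_le hσ.le hmN) J
      have hgt0 : 0 ≤ geomTail uniformProfile σ J := h.geomTail_nonneg J
      -- numerics
      have hτeq : 4 * (((J : ℝ) + 1) * 2 ^ J * τ) = b := by
        rw [hτ]; field_simp
      calc |qN uniformProfile σ N m - R m|
          ≤ 4 * |(qN uniformProfile σ N m)⁻¹ - (R m)⁻¹| := hinv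
        _ ≤ 4 * (((J : ℝ) + 1) * 2 ^ J * τ + contractionC uniformProfile (σ' m) * η +
            2 * geomTail uniformProfile (σ' m) J) := by gcongr
        _ ≤ 4 * (((J : ℝ) + 1) * 2 ^ J * τ + κ * η + 2 * geomTail uniformProfile σ J) := by
            gcongr
        _ = b + 4 * κ * ε + 4 * κ * L * σ ^ 3 * (J : ℝ) * (1 / ((N : ℝ) + 1)) +
            8 * geomTail uniformProfile σ J := by rw [← hτeq, hη]; ring
        _ ≤ b + 4 * κ * ε + b + b := by linarith [hsN.1]
        _ ≤ ε := by rw [hb]; nlinarith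

end Contraction

end LocalGibbsConcentration

end Summit.AtomisticToContinuum.HydrodynamicLimit.Theorems
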